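import Mathlib
import Summits.MatrixMultiplication.MatrixMultiplication.Theorems.SubgroupIdentityDesigns.Negative.OrbitCertificate
import Summits.MatrixMultiplication.MatrixMultiplication.Theorems.SubgroupIdentityDesigns.Negative.ProjectiveReduction

/-!
# Line certificates: the projective form of the three-member exclusion engine (all `p`)

Route `LevelGradedCohnUmans`, crux `SubgroupIdentityDesigns` (stmt-MatrixMultiplication-14079), the
`(m,k) = (2,1)` cell.  VALUE = THEOREM (an all-`p` engine), NOT summit progress; the crux item is
untouched and remains open.

`OrbitCertificate.lean` kills a level-one identity design on a subgroup triple `(H₁, H₂, H₃)` by a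
weight `a` on `H₁ × H₂ × H₃` whose VECTOR incidence counts `Σ_{h₁ k h₃ u = w} a` vanish.  Here the
counts are only required to vanish on LINES: for all `u, b ∈ 𝔽_p²`

  `Σ_{(h₁,k,h₃) : b ⬝ (h₁ k h₃ u) = 0} a(h₁,k,h₃) = 0`     (`u = 0` or `b = 0` says `Σ a = 0`),

provided the SCALAR PARTS `Sᵢ = Hᵢ ∩ Z` cover the centre, `S₁ S₂ S₃ = Z` (which holds as soon as
`|S₁||S₂||S₃| = p - 1`, `ProjectiveReduction.scalar_cover`), and the weight of the scalar triples
`Σ_{h₁ k h₃ ∈ Z} a ≠ 0` (`no_levelOne_design_of_line_certificate`).  Proof: average the design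
function `F = Σ_{rk M ≤ 1} c_M ψ(tr(M ·))` over the punctured centre,
`Σ_{λ ∈ 𝔽_pˣ} F(λ g) = Σ_M c_M (p·[tr(M g) = 0] - 1)` (`Σ_{λ ∈ 𝔽_pˣ} ψ(λ y) = p[y = 0] - 1`), a
combination of LINE indicators `[b ⬝ (g u) = 0]` (`M = u bᵀ`); on the group side, by the scalar
cover `λ · h₁ k h₃ = (s₁h₁)(s₂k)(s₃h₃) ∈ H₁H₂H₃`, so `Σ_λ F(λ h₁kh₃) = [h₁ k h₃ ∈ Z]`.

Application — **a LINE-TRANSITIVE member kills the triple** (`no_levelOne_design_of_lineTransitive₁₂`,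
`₂₃`, `₃₂`): if the triple is subgroup-TPP with `S₁S₂S₃ = Z`, one member acts transitively on the
`p + 1` lines of `𝔽_p²`, and another member contains a non-scalar element `h`, then there is no
level-one identity design: the two-coset weight `[k = 1] - [k = h]` on that other member has the same
line counts for `k = 1` and `k = h` (re-index the transitive member), while by TPP the only scalar
triple products are the products of scalars.  This is the all-`p` mechanism behind the rational
certificates found by the censuses at `p = 61, 157, 181` (route folder `ORACLE-g16.md` §G16-5) and it
closes family I of the Dickson sieve (`SingerLineTransitive.lean`, `CellTwoOneClosed.lean`).
-/

set_option linter.dupNamespace false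

noncomputable section

open scoped BigOperators Classical

open Summit.MatrixMultiplication.MatrixMultiplication.Theorems.LieRankDesigns.Negative (GLm Mat)

namespace Summit.MatrixMultiplication.MatrixMultiplication.Theorems.SubgroupIdentityDesigns.Negative

section LineCertificate

open Literature.Barriers.MatrixMultiplication (SubgroupTPP)

variable {p : ℕ} [hp : Fact p.Prime]

/-! ## Sums over the punctured centre -/

/-- `Σ_{x ∈ 𝔽_p} f(x) = f(0) + Σ_{λ ∈ 𝔽_pˣ} f(λ)`. -/
theorem sum_eq_zero_add_sum_units (f : ZMod p → ℂ) :
    ∑ x : ZMod p, f x = f 0 + ∑ l : (ZMod p)ˣ, f (l : ZMod p) := by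
  rw [Fintype.sum_eq_add_sum_compl (0 : ZMod p) f]
  congr 1
  rw [Finset.sum_subtype ({0}ᶜ : Finset (ZMod p)) (p := fun x : ZMod p => x ≠ 0)
    (fun x => by rw [Finset.mem_compl, Finset.mem_singleton])]
  exact (Fintype.sum_equiv unitsEquivNeZero (fun l : (ZMod p)ˣ => f (l : ZMod p))
    (fun x : {x : ZMod p // x ≠ 0} => f (x : ZMod p)) (fun _ => rfl)).symm

/-- `Σ_{λ ∈ 𝔽_pˣ} ψ(λ y) = p·[y = 0] - 1`. -/
theorem sum_units_stdAddChar_mul (y : ZMod p) :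
    ∑ l : (ZMod p)ˣ, (ZMod.stdAddChar ((l : ZMod p) * y) : ℂ) =
      (if y = 0 then (p : ℂ) else 0) - 1 := by
  have hfull : ∑ x : ZMod p, (ZMod.stdAddChar (x * y) : ℂ) = if y = 0 then (p : ℂ) else 0 := by
    rw [AddChar.sum_mulShift y (ZMod.isPrimitive_stdAddChar p), ZMod.card]
    split_ifs <;> simp
  rw [sum_eq_zero_add_sum_units (fun x => (ZMod.stdAddChar (x * y) : ℂ)), zero_mul,
    AddChar.map_zero_eq_one] at hfull
  rw [← hfull]
  ring

/-! ## Scalars -/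

/-- `(λ·1) g` has matrix `λ • g`. -/
theorem coe_scalarHom_mul (l : (ZMod p)ˣ) (g : GLm p 2) :
    ((scalarHom p 2 l * g : GLm p 2) : Mat p 2) = (l : ZMod p) • (g : Mat p 2) := by
  rw [Units.val_mul, coe_scalarHom, Matrix.scalar_apply, ← Matrix.smul_eq_diagonal_mul]

/-- Scalars are central: three interleaved scalars collect in front. -/
theorem scalarHom_triple_mul (u₁ u₂ u₃ : (ZMod p)ˣ) (x y z : GLm p 2) :
    scalarHom p 2 u₁ * x * (scalarHom p 2 u₂ * y) * (scalarHom p 2 u₃ * z) =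
      scalarHom p 2 u₁ * scalarHom p 2 u₂ * scalarHom p 2 u₃ * (x * y * z) := by
  have hcomm : ∀ (u : (ZMod p)ˣ) (g : GLm p 2), g * scalarHom p 2 u = scalarHom p 2 u * g :=
    fun u g => (scalarHom_comm u g).symm
  calc scalarHom p 2 u₁ * x * (scalarHom p 2 u₂ * y) * (scalarHom p 2 u₃ * z)
      = scalarHom p 2 u₁ * (x * scalarHom p 2 u₂) * (y * scalarHom p 2 u₃) * z := by
        simp only [mul_assoc]
    _ = scalarHom p 2 u₁ * (scalarHom p 2 u₂ * x) * (scalarHom p 2 u₃ * y) * z := by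
        rw [hcomm u₂ x, hcomm u₃ y]
    _ = scalarHom p 2 u₁ * scalarHom p 2 u₂ * (x * scalarHom p 2 u₃) * y * z := by
        simp only [mul_assoc]
    _ = scalarHom p 2 u₁ * scalarHom p 2 u₂ * (scalarHom p 2 u₃ * x) * y * z := by
        rw [hcomm u₃ x]
    _ = scalarHom p 2 u₁ * scalarHom p 2 u₂ * scalarHom p 2 u₃ * (x * y * z) := by
        simp only [mul_assoc]

/-- `#{λ ∈ 𝔽_pˣ : λ g = 1} = [g ∈ Z]`. -/
theorem sum_units_ite_scalarHom_mul_eq_one (g : GLm p 2) :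
    ∑ l : (ZMod p)ˣ, (if scalarHom p 2 l * g = 1 then (1 : ℂ) else 0) =
      if g ∈ (scalarHom p 2).range then 1 else 0 := by
  by_cases hg : g ∈ (scalarHom p 2).range
  · rw [if_pos hg]
    obtain ⟨ν, hν⟩ := hg
    have key : ∀ l : (ZMod p)ˣ, scalarHom p 2 l * g = 1 ↔ l = ν⁻¹ := by
      intro l
      rw [mul_eq_one_iff_eq_inv, ← hν, ← map_inv, scalarHom_injective.eq_iff]
    simp_rw [key]
    simp
  · rw [if_neg hg]
    refine Finset.sum_eq_zero fun l _ => ?_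
    rw [if_neg]
    intro h1
    apply hg
    rw [mul_eq_one_iff_eq_inv] at h1
    exact ⟨l⁻¹, by rw [map_inv, h1, inv_inv]⟩

/-- An invertible `2 × 2` matrix kills no non-zero vector. -/
theorem gl2_mulVec_ne_zero (g : GLm p 2) {v : Fin 2 → ZMod p} (hv : v ≠ 0) :
    (g : Mat p 2).mulVec v ≠ 0 := by
  intro h0
  apply hv
  have := congrArg ((g⁻¹ : GLm p 2) : Mat p 2).mulVec h0
  rwa [Matrix.mulVec_mulVec, ← Units.val_mul, inv_mul_cancel, Units.val_one, Matrix.one_mulVec,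
    Matrix.mulVec_zero] at this

/-! ## The line-certificate engine -/

/-- **LINE CERTIFICATE ⇒ NO LEVEL-ONE IDENTITY DESIGN.**  Let the scalar parts of `(H₁, H₂, H₃)`
cover the centre (`S₁S₂S₃ = Z`, e.g. from `scalar_cover`), and let `a` be a weight on
`H₁ × H₂ × H₃` with non-zero total weight on the triples whose product is scalar and whose LINE
incidence counts `Σ_{b ⬝ (h₁ k h₃ u) = 0} a(h₁,k,h₃)` vanish for all `u, b ∈ 𝔽_p²`.  Then the
level-`1` identity design of the crux does not exist.  All `p`; no TPP, no volume hypothesis. -/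
theorem no_levelOne_design_of_line_certificate {H₁ H₂ H₃ : Subgroup (GLm p 2)}
    (hZ : ∀ z ∈ (scalarHom p 2).range, ∃ s₁ ∈ H₁ ⊓ (scalarHom p 2).range,
      ∃ s₂ ∈ H₂ ⊓ (scalarHom p 2).range, ∃ s₃ ∈ H₃ ⊓ (scalarHom p 2).range, s₁ * s₂ * s₃ = z)
    (a : GLm p 2 → GLm p 2 → GLm p 2 → ℂ)
    (hii : (∑ h₁ : H₁, ∑ k : H₂, ∑ h₃ : H₃,
      if ((h₁ : GLm p 2) * k * h₃ : GLm p 2) ∈ (scalarHom p 2).range then a h₁ k h₃ else 0) ≠ 0)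
    (hline : ∀ u b : Fin 2 → ZMod p, (∑ h₁ : H₁, ∑ k : H₂, ∑ h₃ : H₃,
      if b ⬝ᵥ (((h₁ : GLm p 2) * k * h₃ : GLm p 2) : Mat p 2).mulVec u = 0
        then a h₁ k h₃ else 0) = 0) :
    ¬ ∃ c : Mat p 2 → ℂ, (∀ M, 1 < M.rank → c M = 0) ∧
      (∑ M, c M * ZMod.stdAddChar (Matrix.trace (M * ((1 : GLm p 2) : Mat p 2)))) = 1 ∧
      ∀ a ∈ H₁, ∀ b ∈ H₂, ∀ g ∈ H₃, a * b * g ≠ 1 →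
        (∑ M, c M *
          ZMod.stdAddChar (Matrix.trace (M * ((a * b * g : GLm p 2) : Mat p 2)))) = 0 := by
  rintro ⟨c, hc, hc1, hc0⟩
  obtain ⟨F, hF⟩ : ∃ F : Mat p 2 → ℂ,
      ∀ X, F X = ∑ M, c M * ZMod.stdAddChar (Matrix.trace (M * X)) := ⟨_, fun _ => rfl⟩
  rw [← hF] at hc1
  simp_rw [← hF] at hc0
  -- (1) group side: the value of `F` at a scalar multiple of a triple product
  have hval : ∀ (h₁ : H₁) (k : H₂) (h₃ : H₃) (l : (ZMod p)ˣ),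
      F ((scalarHom p 2 l * ((h₁ : GLm p 2) * k * h₃) : GLm p 2) : Mat p 2) =
        if scalarHom p 2 l * ((h₁ : GLm p 2) * k * h₃) = 1 then 1 else 0 := by
    intro h₁ k h₃ l
    obtain ⟨s₁, hs₁, s₂, hs₂, s₃, hs₃, hprod⟩ := hZ (scalarHom p 2 l) ⟨l, rfl⟩
    obtain ⟨hs₁H, u₁, rfl⟩ := Subgroup.mem_inf.mp hs₁
    obtain ⟨hs₂H, u₂, rfl⟩ := Subgroup.mem_inf.mp hs₂
    obtain ⟨hs₃H, u₃, rfl⟩ := Subgroup.mem_inf.mp hs₃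
    have hGL : scalarHom p 2 u₁ * h₁ * (scalarHom p 2 u₂ * k) * (scalarHom p 2 u₃ * h₃) =
        scalarHom p 2 l * ((h₁ : GLm p 2) * k * h₃) := by
      rw [scalarHom_triple_mul, hprod]
    rw [← hGL]
    by_cases h1 : scalarHom p 2 u₁ * ↑h₁ * (scalarHom p 2 u₂ * ↑k) * (scalarHom p 2 u₃ * ↑h₃) = 1
    · rw [if_pos h1, h1]
      exact hc1
    · rw [if_neg h1]
      exact hc0 _ (H₁.mul_mem hs₁H h₁.2) _ (H₂.mul_mem hs₂H k.2) _ (H₃.mul_mem hs₃H h₃.2) h1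
  -- (2) group side, summed over the punctured centre
  have hgrp : ∀ (h₁ : H₁) (k : H₂) (h₃ : H₃),
      ∑ l : (ZMod p)ˣ, F ((l : ZMod p) • (((h₁ : GLm p 2) * k * h₃ : GLm p 2) : Mat p 2)) =
        if ((h₁ : GLm p 2) * k * h₃ : GLm p 2) ∈ (scalarHom p 2).range then 1 else 0 := by
    intro h₁ k h₃
    rw [← sum_units_ite_scalarHom_mul_eq_one]
    refine Finset.sum_congr rfl fun l _ => ?_
    rw [← coe_scalarHom_mul, hval]
  -- (3) character side: the projectivisation of `F` is a combination of line indicators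
  have hchar : ∀ X : Mat p 2, ∑ l : (ZMod p)ˣ, F ((l : ZMod p) • X) =
      ∑ M : Mat p 2, c M * ((if Matrix.trace (M * X) = 0 then (p : ℂ) else 0) - 1) := by
    intro X
    simp_rw [hF]
    rw [Finset.sum_comm]
    refine Finset.sum_congr rfl fun M _ => ?_
    rw [← Finset.mul_sum]
    congr 1
    simp_rw [Matrix.mul_smul, Matrix.trace_smul, smul_eq_mul]
    exact sum_units_stdAddChar_mul _
  -- (4) the total weight vanishes (`u = b = 0`)
  have hsum0 : (∑ h₁ : H₁, ∑ k : H₂, ∑ h₃ : H₃, a h₁ k h₃) = 0 := by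
    have h := hline 0 0
    simpa using h
  -- (5) every Fourier mode of the projectivised weighted sum vanishes
  have hM : ∀ M : Mat p 2, c M * (∑ h₁ : H₁, ∑ k : H₂, ∑ h₃ : H₃, a h₁ k h₃ *
      ((if Matrix.trace (M * (((h₁ : GLm p 2) * k * h₃ : GLm p 2) : Mat p 2)) = 0
        then (p : ℂ) else 0) - 1)) = 0 := by
    intro M
    by_cases hcM : c M = 0
    · rw [hcM, zero_mul]
    have hrk : M.rank ≤ 1 := by
      by_contra h
      exact hcM (hc M (by omega))
    have hsplit : ∀ (x : ℂ) (P : Prop) [Decidable P],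
        x * ((if P then (p : ℂ) else 0) - 1) = (p : ℂ) * (if P then x else 0) - x := by
      intro x P _
      split_ifs <;> ring
    simp_rw [hsplit, Finset.sum_sub_distrib, ← Finset.mul_sum, hsum0, sub_zero]
    by_cases hM0 : M = 0
    · subst hM0
      simp only [zero_mul, Matrix.trace_zero, if_true]
      rw [hsum0, mul_zero, mul_zero]
    obtain ⟨u, b, -, rfl⟩ := exists_vecMulVec_of_rank_le_one M hrk hM0
    simp_rw [trace_vecMulVec_mul]
    rw [hline u b, mul_zero, mul_zero]
  -- (6) sum swap
  have hswap : (∑ M : Mat p 2, c M * ∑ h₁ : H₁, ∑ k : H₂, ∑ h₃ : H₃, a h₁ k h₃ *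
      ((if Matrix.trace (M * (((h₁ : GLm p 2) * k * h₃ : GLm p 2) : Mat p 2)) = 0
        then (p : ℂ) else 0) - 1)) =
      ∑ h₁ : H₁, ∑ k : H₂, ∑ h₃ : H₃, a h₁ k h₃ * ∑ M : Mat p 2, c M *
        ((if Matrix.trace (M * (((h₁ : GLm p 2) * k * h₃ : GLm p 2) : Mat p 2)) = 0
          then (p : ℂ) else 0) - 1) := by
    simp_rw [Finset.mul_sum]
    rw [Finset.sum_comm]
    refine Finset.sum_congr rfl fun h₁ _ => ?_
    rw [Finset.sum_comm]
    refine Finset.sum_congr rfl fun k _ => ?_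
    rw [Finset.sum_comm]
    exact Finset.sum_congr rfl fun h₃ _ => Finset.sum_congr rfl fun M _ => by ring
  -- (7) assemble
  apply hii
  calc (∑ h₁ : H₁, ∑ k : H₂, ∑ h₃ : H₃,
        if ((h₁ : GLm p 2) * k * h₃ : GLm p 2) ∈ (scalarHom p 2).range then a h₁ k h₃ else 0)
      = ∑ h₁ : H₁, ∑ k : H₂, ∑ h₃ : H₃, a h₁ k h₃ *
          ∑ l : (ZMod p)ˣ, F ((l : ZMod p) • (((h₁ : GLm p 2) * k * h₃ : GLm p 2) : Mat p 2)) := by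
        refine Finset.sum_congr rfl fun h₁ _ => Finset.sum_congr rfl fun k _ =>
          Finset.sum_congr rfl fun h₃ _ => ?_
        rw [hgrp]
        split_ifs <;> simp
    _ = ∑ h₁ : H₁, ∑ k : H₂, ∑ h₃ : H₃, a h₁ k h₃ * ∑ M : Mat p 2, c M *
          ((if Matrix.trace (M * (((h₁ : GLm p 2) * k * h₃ : GLm p 2) : Mat p 2)) = 0
            then (p : ℂ) else 0) - 1) := by
        simp_rw [hchar]
    _ = ∑ M : Mat p 2, c M * ∑ h₁ : H₁, ∑ k : H₂, ∑ h₃ : H₃, a h₁ k h₃ *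
          ((if Matrix.trace (M * (((h₁ : GLm p 2) * k * h₃ : GLm p 2) : Mat p 2)) = 0
            then (p : ℂ) else 0) - 1) := hswap.symm
    _ = 0 := Finset.sum_eq_zero fun M _ => hM M

end LineCertificate

end Summit.MatrixMultiplication.MatrixMultiplication.Theorems.SubgroupIdentityDesigns.Negative

end
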